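import Summits.ResolutionOfSingularities.ResolutionOfSingularities.Theorems.HilbertSamuelEliminationSigmaMaxModificationsCorridor3WLadderE1SocketIso
import Literature.AlgebraicGeometry.Resolution.PermissibleBlowupHilbertSamuel
import HarnessLib

/-!
# [OURS · L1 W4.2] The `e = 1` door OUTSIDE the hypersurface cell — **ISOLATION PERSISTS ALONG AN `e = 1` NEAR STEP OF A POINT TOWER**
# (crux `SigmaMaxModifications` stmt-ResolutionOfSingularities-18506 / conjunct stmt-…-19249, line `w_ladder_rows` v8.5, row `stub_twoClaims` (β);
# `--supports 19249`, helper)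

Stub worker res-L1-w42-stub-3 (gen 6). Sorry-free PROOF file, no definition, no named fact beyond the door `Thm314_point_locus_geomDir` (⟸ F-51′).
OURS bookkeeping for the W4.2 crux chain (cell res-hironaka); NOT a statement of [Hironaka2017] nor of [CossartJannsenSaito2020]. AI-written;
AI review is weaker than expert review.

Along a point tower `(T, y)` over a maximal origin (`C_n = {y_n}`, `π_n y_{n+1} = y_n`, `H^3(y_n) = ν`, `e(y_n) = 1`, `ē(y_n) ≤ 2`): if `y_n` is
ISOLATED in `(X_n)_max` then so is `y_{n+1}` in `(X_{n+1})_max` (`E1Free.isIsolatedInHSMaxLocus_succ_of_pointTower`), hence at every stage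
(`…_of_pointTower`). Proof: take `U ∋ y_n` open with `U ∩ (X_n)_max = {y_n}`; for `z ∈ π_n⁻¹(U) ∩ (X_{n+1})_max` with `π_n z ≠ y_n`, `π_n` is an
isomorphism near `z` (`IsBlowup.hsFun_eq_of_not_mem_support`, `IsBlowup.isIso_compl`), every value of `X_n` is a value of `X_{n+1}` or `ν`, so
`H(π_n z) = H(z)` would be maximal on `X_n` — excluded by `U`; hence `π_n z = y_n`, `H(z) ≤ H(y_n) = ν` (CJS Thm. 3.10 (1),
`IsBlowup.hsFun_le_of_isPermissible`) is maximal and `ν` is a value of `X_{n+1}`, so `H(z) = ν`: `z` is NEAR, lies on `ℙ(Dir(y_n))` by the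
(F1♯) door at `ē ≤ 2`, and `ℙ(Dir) = {y_{n+1}}` since `e = 1` (`projDir_line`). This is the object (H4-i) of res-D-pv-038's 15:58:04Z
note, needed after all by the general-edim `e = 1` door (stub-2's arc assembly reads isolation at stage `1`).

[OURS · L1 W4.2; AI-written] [cite: CossartJannsenSaito2020, Thm. 3.10 (1), Cor. 3.12, Thm. 3.14, Def. 6.34] [cite: StacksProject, Tag 02OS]
-/

set_option linter.dupNamespace false

noncomputable section

open CategoryTheory CategoryTheory.Limits AlgebraicGeometry TopologicalSpace IsLocalRing
open Literature.RingTheory.HilbertSamuel Literature.AlgebraicGeometry.Resolution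
open Literature.AlgebraicGeometry.CossartJannsenSaito2020
open Scheme.IdealSheafData
open Summit.ResolutionOfSingularities.ResolutionOfSingularities.Theorems.CampaignW42
open Summit.ResolutionOfSingularities.ResolutionOfSingularities.Theorems.SigmaMaxModificationsCorridor3
open Summit.ResolutionOfSingularities.ResolutionOfSingularities.Theorems.SigmaMaxModificationsCorridor3.Moving
open Summit.ResolutionOfSingularities.ResolutionOfSingularities.Cruxes.SigmaMaxModifications.IdeasL1C4

namespace Summit.ResolutionOfSingularities.ResolutionOfSingularities.Theorems.SigmaMaxModificationsCorridor3.E1Free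

universe u

/-- A morphism which is an isomorphism over an open `V` of the target has `V` in its image (the 6-line argument of the tree's
`subset_range_of_isIso_morphismRestrict`, `…AlterationsStableModelMorphism`, recopied to keep this file's imports light). [folklore] -/
theorem subset_range_of_isIso_morphismRestrict' {C X : Scheme.{u}} (β : C ⟶ X) (V : X.Opens) [IsIso (β ∣_ V)] :
    ((V : X.Opens) : Set X) ⊆ Set.range β.base := by
  intro x hx
  obtain ⟨c, hc⟩ := (Scheme.homeoOfIso (asIso (β ∣_ V))).surjective ⟨x, hx⟩
  refine ⟨c.1, ?_⟩
  have := congr_arg Subtype.val hc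
  rw [Scheme.coe_homeoOfIso, asIso_hom, morphismRestrict_base_coe] at this
  exact this

variable {p : ℕ} {ν : ℕ → ℕ} {T : BlowupTower.{u}} {y : ∀ n, T.X n}

/-- **ISOLATION PERSISTS ALONG ONE `e = 1` NEAR STEP OF A POINT TOWER** (module docstring). [OURS · L1 W4.2; AI-written]
[cite: CossartJannsenSaito2020, Thm. 3.10 (1), Cor. 3.12, Thm. 3.14, Def. 6.34] [cite: StacksProject, Tag 02OS] -/
theorem isIsolatedInHSMaxLocus_succ_of_pointTower (h214 : Thm314_point_locus_geomDir.{u})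
    (hC : ∀ n, T.C n = {y n}) (hover : ∀ n, (T.π n).base (y (n + 1)) = y n) (hycl : ∀ n, IsClosed ({y n} : Set (T.X n)))
    (hH : ∀ n, Scheme.hsFun (T.X n) 3 (y n) = ν) (hO : IsMaximalOrigin p 3 ν (T.X 0) (y 0))
    (heT : ∀ n, @Scheme.dirDim (T.X n) (T.ln n) (y n) = 1) (hGT : ∀ n, @Scheme.geomDirDim (T.X n) (T.ln n) (y n) ≤ 2)
    (n : ℕ) (hiso : @IsIsolatedInHSMaxLocus (T.X n) (T.ln n) 3 (y n)) :
    @IsIsolatedInHSMaxLocus (T.X (n + 1)) (T.ln (n + 1)) 3 (y (n + 1)) := by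
  classical
  haveI : ∀ j, IsLocallyNoetherian (T.X j) := T.ln
  -- structure over the field of the origin: excellence, dimension, every stage a maximal origin
  obtain ⟨k, _, _, f₀, hsep, hft, hqc⟩ := hO.exists_structure
  haveI := hsep
  haveI := hft
  haveI := hqc
  obtain ⟨f, -, hf1, -⟩ := exists_towerStructure T f₀
  have hexc : ∀ j, Scheme.IsExcellent (T.X j) := fun j =>
    haveI := hf1 j
    Scheme.isExcellent_of_locallyOfFiniteType Stacks07QW_field_holds (f j)
  have hdim : ∀ j, topologicalKrullDim (T.X j) ≤ ((3 : ℕ) : WithBot ℕ∞) := tower_dim_le T hO.dim_le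
  have hblow : ∀ j, IsBlowup (T.π j) (vanishingIdeal ⟨{y j}, hycl j⟩) := IsoTailsHS.isBlowup_singleton_of_pointTower hC hycl
  have hperm : ∀ j, IdealSheafData.IsPermissible (vanishingIdeal (⟨{y j}, hycl j⟩ : Closeds (T.X j))) := fun j =>
    isPermissible_singleton_of_one_le_dirDim (hycl j) (heT j).symm.le
  have he1 : ∀ j, 1 ≤ @Scheme.geomDirDim (T.X j) (T.ln j) (y j) := fun j =>
    le_trans (heT j).ge (Scheme.dirDim_le_geomDirDim (y j))
  have hOn : ∀ j, IsMaximalOrigin p 3 ν (T.X j) (y j) := IsoTailsHS.isMaximalOrigin_of_pointTower hC hycl hH he1 hO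
  -- CJS Thm. 3.10 (1) along `π_n` and `ℙ(Dir(y_n))`
  have hmono : ∀ z : T.X (n + 1), Scheme.hsFun (T.X (n + 1)) 3 z ≤ Scheme.hsFun (T.X n) 3 ((T.π n).base z) :=
    fun z => (hblow n).hsFun_le_of_isPermissible (hexc n) (hperm n) 3 z
  have hon : ∀ z : T.X (n + 1), (T.π n).base z = y n → Scheme.hsFun (T.X (n + 1)) 3 z = ν → IsOnProjDirectrix (T.π n) z :=
    fun z hz hzν => h214 (T.X n) (T.X (n + 1)) (T.π n) (y n) (hycl n) 3 z (hexc n) (hperm n) (hblow n) (hdim n) hz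
      (geomDirHypothesis_of_geomDirDim_le_two (hGT n)) (by rw [hzν, hH n])
  have hline := (projDir_line (T.X n) (T.X (n + 1)) (T.π n) (y n) (hycl n) (hblow n) (heT n)).1
  -- values of `X_n` off `y_n` are values of `X_{n+1}`
  have hval : ∀ w : T.X n, w ≠ y n → ∃ w' : T.X (n + 1), (T.π n).base w' = w ∧
      Scheme.hsFun (T.X (n + 1)) 3 w' = Scheme.hsFun (T.X n) 3 w := by
    intro w hw
    have hws : w ∉ (vanishingIdeal (⟨{y n}, hycl n⟩ : Closeds (T.X n))).support := by
      rw [← SetLike.mem_coe, Scheme.IdealSheafData.coe_support_vanishingIdeal]; exact hw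
    haveI := (hblow n).isIso_compl
    obtain ⟨w', hw'⟩ := subset_range_of_isIso_morphismRestrict' (T.π n)
      ⟨((vanishingIdeal (⟨{y n}, hycl n⟩ : Closeds (T.X n))).support : Set (T.X n))ᶜ,
        (vanishingIdeal (⟨{y n}, hycl n⟩ : Closeds (T.X n))).support.isClosed.isOpen_compl⟩ hws
    refine ⟨w', hw', ?_⟩
    have hws' : (T.π n).base w' ∉ (vanishingIdeal (⟨{y n}, hycl n⟩ : Closeds (T.X n))).support := by rw [hw']; exact hws
    rw [(hblow n).hsFun_eq_of_not_mem_support w' hws' 3, hw']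
  -- the neighbourhood
  obtain ⟨U, hU, hUmax⟩ := hiso
  have hyU : y n ∈ U := by
    have : y n ∈ U ∩ Scheme.hsMaxLocus (T.X n) 3 := by rw [hUmax]; exact Set.mem_singleton _
    exact this.1
  refine ⟨(T.π n).base ⁻¹' U, hU.preimage (T.π n).continuous, ?_⟩
  ext z
  constructor
  · rintro ⟨hzU, hzmax⟩
    have hzmax' : Maximal (· ∈ Scheme.hsValues (T.X (n + 1)) 3) (Scheme.hsFun (T.X (n + 1)) 3 z) := hzmax
    have hνval : ν ∈ Scheme.hsValues (T.X (n + 1)) 3 := ⟨y (n + 1), hH (n + 1)⟩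
    -- `π_n z = y_n`
    have hπz : (T.π n).base z = y n := by
      by_contra hne
      -- off the centre `H(z) = H(π z)`, and `H(π z)` would be maximal on `X_n`
      have hzs : (T.π n).base z ∉ (vanishingIdeal (⟨{y n}, hycl n⟩ : Closeds (T.X n))).support := by
        rw [← SetLike.mem_coe, Scheme.IdealSheafData.coe_support_vanishingIdeal]; exact hne
      have heq := (hblow n).hsFun_eq_of_not_mem_support z hzs 3
      have hmax : (T.π n).base z ∈ Scheme.hsMaxLocus (T.X n) 3 := by
        rw [Scheme.mem_hsMaxLocus_iff, ← heq]
        refine ⟨⟨(T.π n).base z, heq.symm⟩, fun μ hμ hle => ?_⟩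
        obtain ⟨w, rfl⟩ := hμ
        by_cases hw : w = y n
        · subst hw
          rw [hH n] at hle ⊢
          exact hzmax'.2 hνval hle
        · obtain ⟨w', hw', hHw'⟩ := hval w hw
          rw [← hHw'] at hle ⊢
          exact hzmax'.2 ⟨w', rfl⟩ hle
      have : (T.π n).base z ∈ U ∩ Scheme.hsMaxLocus (T.X n) 3 := ⟨hzU, hmax⟩
      rw [hUmax] at this
      exact hne this
    -- `z` is near, hence on `ℙ(Dir(y_n)) = {y_{n+1}}`
    have hle : Scheme.hsFun (T.X (n + 1)) 3 z ≤ ν := by rw [← hH n, ← hπz]; exact hmono z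
    have hzν : Scheme.hsFun (T.X (n + 1)) 3 z = ν := le_antisymm hle (hzmax'.2 hνval hle)
    have hfz : z ∈ projDirectrixFibre (T.π n) (y n) := ⟨hπz, hon z hπz hzν⟩
    have hfy : y (n + 1) ∈ projDirectrixFibre (T.π n) (y n) := ⟨hover n, hon (y (n + 1)) (hover n) (hH (n + 1))⟩
    exact hline hfz hfy
  · intro hz
    rw [Set.mem_singleton_iff] at hz
    subst hz
    refine ⟨show (T.π n).base (y (n + 1)) ∈ U by rw [hover n]; exact hyU, ?_⟩
    show Maximal (· ∈ Scheme.hsValues (T.X (n + 1)) 3) (Scheme.hsFun (T.X (n + 1)) 3 (y (n + 1)))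
    rw [hH (n + 1)]
    exact (hOn (n + 1)).maximal

/-- **Isolation at EVERY stage of an `e = 1` point tower isolated at its base.** [OURS · L1 W4.2; AI-written]
[cite: CossartJannsenSaito2020, Thm. 3.10 (1), Cor. 3.12, Thm. 3.14] -/
theorem isIsolatedInHSMaxLocus_of_pointTower (h214 : Thm314_point_locus_geomDir.{u})
    (hC : ∀ n, T.C n = {y n}) (hover : ∀ n, (T.π n).base (y (n + 1)) = y n) (hycl : ∀ n, IsClosed ({y n} : Set (T.X n)))
    (hH : ∀ n, Scheme.hsFun (T.X n) 3 (y n) = ν) (hO : IsMaximalOrigin p 3 ν (T.X 0) (y 0))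
    (heT : ∀ n, @Scheme.dirDim (T.X n) (T.ln n) (y n) = 1) (hGT : ∀ n, @Scheme.geomDirDim (T.X n) (T.ln n) (y n) ≤ 2)
    (hiso : @IsIsolatedInHSMaxLocus (T.X 0) (T.ln 0) 3 (y 0)) (n : ℕ) :
    @IsIsolatedInHSMaxLocus (T.X n) (T.ln n) 3 (y n) := by
  induction n with
  | zero => exact hiso
  | succ n ih => exact isIsolatedInHSMaxLocus_succ_of_pointTower h214 hC hover hycl hH hO heT hGT n ih

end Summit.ResolutionOfSingularities.ResolutionOfSingularities.Theorems.SigmaMaxModificationsCorridor3.E1Free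

end
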